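import Mathlib
import Summits.Ventures.HodgeRepro.Tier4.Common.AdelicDefs
import Summits.Ventures.HodgeRepro.Tier4.Common.SettingOfData
import Summits.Ventures.HodgeRepro.Tier4.Common.MixedPlane
import Summits.Ventures.HodgeRepro.Tier4.Common.RowPlane
import Summits.Ventures.HodgeRepro.Tier4.Common.RowTorus
import Summits.Ventures.HodgeRepro.Tier4.Line1.RTFSetting
import Summits.Ventures.HodgeRepro.Tier4.Line1.PlaneDefs
import Summits.Ventures.HodgeRepro.Tier4.Line4.LevelCosetCongruence
import Summits.Ventures.HodgeRepro.Tier4.Line4.OrbitInvariant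
import Summits.Ventures.HodgeRepro.Tier4.Line4.OrbitInvariantFibre
import Summits.Ventures.HodgeRepro.Tier4.Line4.LinRegularCoords

/-!
# Tier4/Line4/LinRegularBridge — the fibre bridge with `IsLinRegular` binders (C-L4-REGCOORD, composed)

Blind re-derivation cell `pub-hodge-repro`, Tier 4 «prove the step» (README §9–§10), seat t4-L1-p3 (gen 4).
Tree path `lean/Summits/Ventures/HodgeRepro/Tier4/Line4/LinRegularBridge.lean`.

OrbitInvariantFibre's `orbitInv_ne_of_orbitOf_ne` (p705792) binds the coordinate regularity `hreg`/`hreg₀` of the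
`k`-matrices `m`, `m₀` of `γ`, `γ₀`; LinRegularCoords' `hreg_of_isLinRegular` (p708292) derives it from
`Line1.IsLinRegular`.  Composed here: **`IsLinRegular W γ → IsLinRegular W γ₀ → orbitOf γ ≠ orbitOf γ₀ →
orbitInv γ ≠ orbitInv γ₀`** — no matrix binders (`exists_rational_mat_of_mem_rationalPoints` supplies them), the
`hbridge` hypothesis of the `hR` wrapper (x2 g5 S15440) in the vocabulary of the (S-DICH) display.  No printed input.
HC_CM is NOT proved by anyone in this repository.
-/

namespace Summit.Ventures.HodgeRepro.Tier4.Line4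

open Summit.Ventures.HodgeRepro.Tier4.Common Summit.Ventures.HodgeRepro.Tier4.Line1.RTF NumberField Matrix
  MeasureTheory
open scoped NumberField

noncomputable section

section Bridge

variable {k : Type} [Field k] [NumberField k] (q : QuadData k) (a b ε a' b' ε' : k)
  (g g' : Matrix (Fin 4) (Fin 4) k) (hgg' : g * g' = 1) (hg'g : g' * g = 1)
  (hgΩ : g * (PlaneData.ofLinesRow q a b ε).Ω = (PlaneData.ofLinesRow q a b ε).Ω * g)
  (W : PlaneData k) (hW : W = (PlaneData.ofLinesRow q a b ε).withTransportedTorus g g' hgg' hg'g hgΩ)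
  [MeasurableSpace (GA W)] [BorelSpace (GA W)] (R : RTFData W) (μ : Measure (GA W))
  [μ.IsHaarMeasure] [R.μT.IsHaarMeasure] [R.μT'.IsHaarMeasure] (DG : Set (GA W))
  (fdG : IsFundamentalDomain (rationalPoints W) DG μ) (compG : IsCompact (closure DG))
  (compT : IsCompact (closure R.DT)) (compT' : IsCompact (closure R.DT'))

include hW in
/-- **OFF THE ORBIT, OFF THE FIBRE, with `IsLinRegular` binders**: on the transported row plane (`t = 0`,
`¬ IsSquare (−n)`, similitude `g B′ gᵀ = λ B`), two linearly regular rational points in different orbits of the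
Setting have different orbit invariants. -/
theorem orbitInv_ne_of_orbitOf_ne_of_isLinRegular (ht : q.t = 0) (hn : q.n ≠ 0) (hd : ¬ IsSquare (-q.n))
    (ha : a ≠ 0) (hb : b ≠ 0) (hε : ε ≠ 0) (ha' : a' ≠ 0) (hb' : b' ≠ 0) (hε' : ε' ≠ 0) (lam : k) (hlam : lam ≠ 0)
    (hiso : g * (PlaneData.ofLinesRow q a' b' ε').B * gᵀ = lam • (PlaneData.ofLinesRow q a b ε).B)
    {γ γ₀ : (Setting.ofAdelicData W R μ DG fdG compG compT compT').Gk}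
    (hreg : Line1.IsLinRegular W γ) (hreg₀ : Line1.IsLinRegular W γ₀)
    (hne : (Setting.ofAdelicData W R μ DG fdG compG compT compT').orbitOf γ ≠
      (Setting.ofAdelicData W R μ DG fdG compG compT compT').orbitOf γ₀) :
    orbitInv W g (γ : GA W) ≠ orbitInv W g (γ₀ : GA W) := by
  have hq : q.t ^ 2 - 4 * q.n ≠ 0 := by
    have h4 : (4 : k) ≠ 0 := by norm_num
    rw [ht, zero_pow two_ne_zero, zero_sub, neg_ne_zero]
    exact mul_ne_zero h4 hn
  obtain ⟨m, hm⟩ := exists_rational_mat_of_mem_rationalPoints W γ.2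
  obtain ⟨m₀, hm₀⟩ := exists_rational_mat_of_mem_rationalPoints W γ₀.2
  subst hW
  exact orbitInv_ne_of_orbitOf_ne q a b ε a' b' ε' g g' hgg' hg'g hgΩ _ rfl R μ DG fdG compG compT compT'
    ht hn hd ha hb hε ha' hb' hε' lam hlam hiso hm hm₀
    (hreg_of_isLinRegular q a b ε a' b' ε' g g' hgg' hg'g hgΩ hq ha hb hε ha' hb' hε' lam hlam hiso hreg hm)
    (hreg_of_isLinRegular q a b ε a' b' ε' g g' hgg' hg'g hgΩ hq ha hb hε ha' hb' hε' lam hlam hiso hreg₀ hm₀) hne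

end Bridge

end

end Summit.Ventures.HodgeRepro.Tier4.Line4
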